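import Mathlib
import HarnessLib

/-!
# A freeness criterion by rank count over a local algebra

Let `R` be a commutative domain and `A` a commutative `R`-algebra which is finite free as an
`R`-module. (1) **Rank criterion**: a surjective `A`-linear map `A^r → M` with
`r · rank_R A ≤ rank_R M` is injective, hence an isomorphism (its kernel is an `R`-submodule of
rank `0` of the torsion-free module `A^r`). (2) **Nakayama step**: for `A` local and `I ≠ ⊤`, elements
of a finite `A`-module `M` whose images generate `M / I M` generate `M`. (3) Together: if `M / I M`
is generated by `r` elements `g` and `r · rank_R A ≤ rank_R M`, then `g` is an `A`-basis and
`M ≅ A^r` is free of rank `r`.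

Textbook commutative algebra, PROVED here (kernel-checked; axioms `propext`, `Classical.choice`,
`Quot.sound`): (2) is Nakayama's lemma in the form [AtiyahMacdonald1969, Prop. 2.8] /
[Matsumura1987, Thm. 2.3] (Mathlib: `LinearMap.surjective_of_surjective_comp_mkQ`); (1) is
rank–nullity over the fraction field of `R` (Mathlib: `Submodule.disjoint_ker_of_finrank_le`);
(3) is the usual "minimal number of generators = rank ⇒ free" criterion for modules over a local
ring that is finite free over a domain (compare [Matsumura1987, Thm. 2.3 and §7]).

USE (why it is here): this is the algebraic half of "LEMMA F (freeness), second proof" of the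
venture cell `pub-abcsig`'s print-derived counting of Eisenstein-congruent newforms
(lit/FLIP-DERIVATION-T1.md §3), applied with `R = ℤ_ℓ`, `A = ℤ_ℓ[P]` (`P` a finite `ℓ`-group),
`I` the augmentation ideal and `M = H₁(Y, S; ℤ_ℓ)₊`; the `ℤ_p[G]` assembly is
`Literature/Algebra/Module/PadicGroupRingFreeness.lean`. Honest framing: pure commutative algebra;
no statement about modular forms or ABC is made here. Authored by the cell's prover seat p1 (g9),
2026-08-23; carried into `Literature/` unchanged (statements and proofs byte-identical; only this
docstring, the namespace and the citation tags were added by the literature seat).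
-/

namespace Literature.Algebra.Module

namespace FreenessCriterion

open _root_.Module Function

variable {R A M : Type*} [CommRing R] [IsDomain R] [CommRing A] [Algebra R A]
  [AddCommGroup M] [Module A M] [Module R M] [IsScalarTower R A M]

/-- **Rank criterion, core form.** A surjective `A`-linear map `A^r → M` is injective as soon as
`r · finrank_R A ≤ finrank_R M`, when `A` is finite free over the domain `R`
(the kernel is an `R`-submodule of rank `0` of the `R`-torsion-free module `A^r`).
[cite: Matsumura1987, §7 (rank over a domain; rank–nullity) — standard; proved here] -/
theorem injective_of_surjective_of_finrank_le [Module.Free R A] [Module.Finite R A]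
    {r : ℕ} (f : (Fin r → A) →ₗ[A] M) (hf : Surjective f)
    (hrank : r * finrank R A ≤ finrank R M) : Injective f := by
  have key := Submodule.disjoint_ker_of_finrank_le (R := R) (M := Fin r → A) (L := ⊤)
    (f.restrictScalars R) ?_
  · rw [top_disjoint] at key
    have hinj : Injective (f.restrictScalars R) := LinearMap.ker_eq_bot.mp key
    exact hinj
  · have hf' : Surjective (f.restrictScalars R) := hf
    rw [Submodule.map_top, LinearMap.range_eq_top.mpr hf', finrank_top, finrank_top]
    simpa [Module.finrank_pi_fintype, Finset.sum_const, smul_eq_mul] using hrank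

/-- **Rank criterion, equivalence form.** Under the hypotheses of
`injective_of_surjective_of_finrank_le`, `f` is a linear equivalence `A^r ≃ M`.
[cite: Matsumura1987, §7 — standard; proved here] -/
noncomputable def equivOfSurjectiveOfFinrankLe [Module.Free R A] [Module.Finite R A]
    {r : ℕ} (f : (Fin r → A) →ₗ[A] M) (hf : Surjective f)
    (hrank : r * finrank R A ≤ finrank R M) : (Fin r → A) ≃ₗ[A] M :=
  LinearEquiv.ofBijective f ⟨injective_of_surjective_of_finrank_le f hf hrank, hf⟩

/-- **Nakayama step.** Over a commutative local ring `A`, if `I` is a proper ideal and the images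
of `g 0, …, g (r-1)` generate `M / I M` for a finite `A`-module `M`, then the `g i` generate `M`,
i.e. the linear-combination map `A^r → M` is surjective.
[cite: AtiyahMacdonald1969, Prop. 2.8] [cite: Matsumura1987, Thm. 2.3] -/
theorem linearCombination_surjective_of_span_sup_eq_top [IsLocalRing A] [Module.Finite A M]
    {I : Ideal A} (hI : I ≠ ⊤) {r : ℕ} (g : Fin r → M)
    (hg : Submodule.span A (Set.range g) ⊔ I • ⊤ = ⊤) :
    Surjective (Fintype.linearCombination A g) := by
  refine LinearMap.surjective_of_surjective_comp_mkQ _ I ?_ ?_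
  · rw [IsLocalRing.jacobson_eq_maximalIdeal ⊥ bot_ne_top]
    exact IsLocalRing.le_maximalIdeal hI
  · rw [← LinearMap.range_eq_top, LinearMap.range_comp, Fintype.range_linearCombination,
      Submodule.map_mkQ_eq_top, sup_comm]
    exact hg

/-- **LEMMA F criterion (lit/FLIP-DERIVATION-T1.md §3, second proof), kernel-checked form.**
Let `A` be a commutative local ring which is finite free over a domain `R`, `I ≠ ⊤` an ideal of
`A`, `M` a finite `A`-module, `g : Fin r → M` elements whose images generate `M / I M`, and suppose
`r · finrank_R A ≤ finrank_R M`. Then `(c ↦ Σ c i • g i) : A^r → M` is bijective; in particular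
`M` is free of rank `r` over `A` with basis `g`. (Application: `R = ℤ_ℓ`, `A = ℤ_ℓ[P]`, `I` the
augmentation ideal, `M = H₁(Y, S; ℤ_ℓ)₊`, `r = g₀ + s − 1`, `finrank_R M = |P| · r`.)
[cite: Matsumura1987, Thm. 2.3 (Nakayama) with §7 (rank) — standard criterion; proved here] -/
theorem linearCombination_bijective [IsLocalRing A] [Module.Free R A] [Module.Finite R A]
    [Module.Finite A M] {I : Ideal A} (hI : I ≠ ⊤) {r : ℕ} (g : Fin r → M)
    (hg : Submodule.span A (Set.range g) ⊔ I • ⊤ = ⊤)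
    (hrank : r * finrank R A ≤ finrank R M) :
    Bijective (Fintype.linearCombination A g) :=
  have hs := linearCombination_surjective_of_span_sup_eq_top hI g hg
  ⟨injective_of_surjective_of_finrank_le _ hs hrank, hs⟩

/-- Under the hypotheses of `linearCombination_bijective`, `g` is an `A`-basis of `M`.
[cite: Matsumura1987, Thm. 2.3 with §7 — standard; proved here] -/
noncomputable def basisOfRankCriterion [IsLocalRing A] [Module.Free R A] [Module.Finite R A]
    [Module.Finite A M] {I : Ideal A} (hI : I ≠ ⊤) {r : ℕ} (g : Fin r → M)
    (hg : Submodule.span A (Set.range g) ⊔ I • ⊤ = ⊤)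
    (hrank : r * finrank R A ≤ finrank R M) : Basis (Fin r) A M :=
  Basis.ofEquivFun
    (LinearEquiv.ofBijective (Fintype.linearCombination A g)
      (linearCombination_bijective hI g hg hrank)).symm

/-- Under the hypotheses of `linearCombination_bijective`, `M` is a free `A`-module
of rank `r`. [cite: Matsumura1987, Thm. 2.3 with §7 — standard; proved here] -/
theorem free_and_finrank_eq [IsLocalRing A] [Module.Free R A] [Module.Finite R A]
    [Module.Finite A M] {I : Ideal A} (hI : I ≠ ⊤) {r : ℕ} (g : Fin r → M)
    (hg : Submodule.span A (Set.range g) ⊔ I • ⊤ = ⊤)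
    (hrank : r * finrank R A ≤ finrank R M) :
    Module.Free A M ∧ finrank A M = r := by
  let b := basisOfRankCriterion hI g hg hrank
  exact ⟨Module.Free.of_basis b, by simpa using finrank_eq_card_basis b⟩

end FreenessCriterion

end Literature.Algebra.Module
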